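import Summits.HodgeConjecture.HodgeConjecture.Theorems.Ring2WeilCoverageCMFieldNormResidueSymbolsDyadic
import Summits.HodgeConjecture.HodgeConjecture.Theorems.Ring2WeilCoverageCMFieldNormResidueSymbolsDyadicResidueFields
import HarnessLib

/-!
# Ring 2 — Weil-family coverage, CM-field rows: THE DYADIC COLUMN of the `T`-labels for the two cubic cyclotomic
  carriers `ℚ(ζ₉)` (dyadic INERT) and `ℚ(ζ₇)` (dyadic SPLIT) of the `g = 12` tables — sub-cell (ix″), part 10
  (WEIL-FAMILY-COVERAGE «## b03»)

research route conditional on HC_CM; not a corollary; Q11.4-sentence-2 already refuted in dim ≥ 3.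

On Deligne's carriers `F = ℚ[S]/(R) = ℚ(θ) ⊂ E = F(√θ)` the rows `W_{2k}.E.δ` are labelled by `T(q) = badPlaces q θ`
[cite: Deligne1982HodgeCycles, §4: display (1), Prop. 4.1, Cor. 4.2]; part 6 decides the dyadic membership under a
dyadic normalisation `θ = c²(1 + 4ρ)` by the Artin–Schreier residue equation `X² - X - ρ` [cite: Omeara1963, §63C
Example 63:16].  The two CUBIC census carriers of §b03.23 (`W12.E.δ`, `E` sextic CM over a real cubic `F`) are
unramified above `2`, with `2` INERT in `F` (residue field `𝔽₈`):

* §19 toolkit (any number field of degree `3`): `N v ∣ 8` at `v ∣ 2`; ONE element with `x² - x ∉ v` and `x⁴ - x ∉ v`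
  certifies `N v = 8`, hence `y⁸ ≡ y (mod v)`, `v = (2)`, uniqueness and `ord_v 2 = 1`. [folklore]
* §20 cubic carriers: `[F:ℚ] = 3`, the root relation in `F` and in `𝓞_F`.
* §21 `ℚ(ζ₉)` (`R = S³ + 6S² + 9S + 3`, `θ = 2cos(2πk/9) - 2`): `θ = (θ² + 5θ + 2)²(1 + 4ρ)`, `ρ = -(2θ² + 11θ + 13)`
  (a cyclotomic-unit square, found by a search mod `4𝓞_F`); Bezout identities for `θ² - θ`, `θ⁴ - θ` against `R`
  mod `2`; the Artin–Schreier trace of `ρ̄ ∈ 𝔽₈` is `1` — an explicit integer identity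
  `1 = (r⁸ - r) - A·(r² - r - ρ) - C·R(θ) - 2B` — so **INERT: `v₂ ∈ T(q) ⟺ ord_{v₂} q` odd**, the dyadic rows
  `[2w] ≠ [(-1)^k]` (§b03.24's `[2] ≠ [1]` uniformly).
* §22 `ℚ(ζ₇)` (`R = S³ + 7S² + 14S + 7`, `θ = 2cos(2πk/7) - 2`): `θ = (θ² + 5θ + 3)²(1 + 4ρ)`, `ρ = -(θ² + 6θ + 9)`;
  `r = θ² + θ` solves `X² - X - ρ ≡ 0 (mod 2)` — **SPLIT: `v₂` lies in no `T(q)`** (§b03.24's `[2] = [1]`).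
With parts 6–9 the dyadic column is decided for all seven quartic and both cubic cyclotomic census carriers.  No new
definition, no named fact, no sorry; nothing about the Hodge conjecture is asserted.
-/

noncomputable section

set_option linter.dupNamespace false

open Polynomial NumberField IsDedekindDomain

namespace Summit.HodgeConjecture.HodgeConjecture.Ring2.WeilCoverageCM

open Literature.AlgebraicGeometry.Deligne1982
open Literature.AlgebraicGeometry.HodgeTheory (splitDiscriminantClassCM)
open Literature.NumberTheory.QuadraticForms

/-! ### §19 Residue fields at the dyadic places of a CUBIC field with `2` inert (toolkit) -/

section CubicToolkit

variable {K : Type*} [Field K] [NumberField K]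

/-- At a dyadic place `v` of a number field of degree `3`: `N v ∣ 8`. [folklore] -/
theorem absNorm_dvd_eight_of_dyadic (hK : Module.finrank ℚ K = 3) (v : HeightOneSpectrum (𝓞 K))
    (h2 : (2 : 𝓞 K) ∈ v.asIdeal) : Ideal.absNorm v.asIdeal ∣ 8 := by
  have h := Ideal.absNorm_dvd_absNorm_of_le ((Ideal.span_singleton_le_iff_mem _).2 h2)
  rwa [absNorm_span_two, hK] at h

/-- **INERT `2` in a cubic field, witnessed by one element: if `x² - x ∉ v` and `x⁴ - x ∉ v` for some `x ∈ 𝓞_K` then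
`N v = 8`** (`N v ∈ {2, 4}` would force `x² ≡ x` resp. `x⁴ ≡ x`). [folklore] -/
theorem absNorm_eq_eight_of_dyadic (hK : Module.finrank ℚ K = 3) (v : HeightOneSpectrum (𝓞 K))
    (h2 : (2 : 𝓞 K) ∈ v.asIdeal) {x : 𝓞 K} (hx2 : x ^ 2 - x ∉ v.asIdeal) (hx4 : x ^ 4 - x ∉ v.asIdeal) :
    Ideal.absNorm v.asIdeal = 8 := by
  have hdvd := absNorm_dvd_eight_of_dyadic hK v h2
  have hne1 : Ideal.absNorm v.asIdeal ≠ 1 := fun h1 ↦ v.isPrime.ne_top (Ideal.absNorm_eq_one_iff.1 h1)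
  have hx := pow_absNorm_sub_self_mem v x
  have h8 : (8 : ℕ) = 2 ^ 3 := by norm_num
  rw [h8, Nat.dvd_prime_pow Nat.prime_two] at hdvd
  obtain ⟨i, hi, heq⟩ := hdvd
  interval_cases i
  · rw [pow_zero] at heq; exact absurd heq hne1
  · rw [heq, pow_one] at hx; exact absurd hx hx2
  · rw [heq] at hx; exact absurd hx hx4
  · rw [heq]; norm_num

/-- Hence **`y⁸ ≡ y (mod v)`** for every `y ∈ 𝓞_K` at such a place (`𝓞_K/v = 𝔽₈`). [folklore] -/
theorem pow_eight_sub_self_mem_of_dyadic (hK : Module.finrank ℚ K = 3) (v : HeightOneSpectrum (𝓞 K))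
    (h2 : (2 : 𝓞 K) ∈ v.asIdeal) {x : 𝓞 K} (hx2 : x ^ 2 - x ∉ v.asIdeal) (hx4 : x ^ 4 - x ∉ v.asIdeal) (y : 𝓞 K) :
    y ^ 8 - y ∈ v.asIdeal := by
  have hy := pow_absNorm_sub_self_mem v y
  rwa [absNorm_eq_eight_of_dyadic hK v h2 hx2 hx4] at hy

/-- … and **`v = (2)`**: the dyadic place is principal, generated by `2`. [folklore] -/
theorem asIdeal_eq_span_two_of_dyadic_cubic (hK : Module.finrank ℚ K = 3) (v : HeightOneSpectrum (𝓞 K))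
    (h2 : (2 : 𝓞 K) ∈ v.asIdeal) {x : 𝓞 K} (hx2 : x ^ 2 - x ∉ v.asIdeal) (hx4 : x ^ 4 - x ∉ v.asIdeal) :
    v.asIdeal = Ideal.span {(2 : 𝓞 K)} := by
  have h8 := absNorm_eq_eight_of_dyadic hK v h2 hx2 hx4
  refine (ideal_eq_of_le_of_absNorm_eq ((Ideal.span_singleton_le_iff_mem _).2 h2) ?_ ?_).symm
  · rw [h8]; norm_num
  · rw [absNorm_span_two, hK, h8]; norm_num

/-- … `ord_v 2 = 1`. [folklore] -/
theorem intValuation_two_of_dyadic_cubic (hK : Module.finrank ℚ K = 3) (v : HeightOneSpectrum (𝓞 K))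
    (h2 : (2 : 𝓞 K) ∈ v.asIdeal) {x : 𝓞 K} (hx2 : x ^ 2 - x ∉ v.asIdeal) (hx4 : x ^ 4 - x ∉ v.asIdeal) :
    v.intValuation (2 : 𝓞 K) = WithZero.exp (-1 : ℤ) :=
  HeightOneSpectrum.intValuation_singleton (v := v) two_ne_zero (asIdeal_eq_span_two_of_dyadic_cubic hK v h2 hx2 hx4)

/-- … and the dyadic place is UNIQUE. [folklore] -/
theorem dyadic_unique_cubic (hK : Module.finrank ℚ K = 3) (v v' : HeightOneSpectrum (𝓞 K))
    (h2 : (2 : 𝓞 K) ∈ v.asIdeal) (h2' : (2 : 𝓞 K) ∈ v'.asIdeal) {x : 𝓞 K}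
    (hx2 : x ^ 2 - x ∉ v.asIdeal) (hx4 : x ^ 4 - x ∉ v.asIdeal)
    (hx2' : x ^ 2 - x ∉ v'.asIdeal) (hx4' : x ^ 4 - x ∉ v'.asIdeal) : v = v' :=
  HeightOneSpectrum.ext (by rw [asIdeal_eq_span_two_of_dyadic_cubic hK v h2 hx2 hx4,
    asIdeal_eq_span_two_of_dyadic_cubic hK v' h2' hx2' hx4'])

end CubicToolkit

/-! ### §20 Cubic carriers `R = S³ + aS² + bS + c`: the degree and the root relation in `𝓞_F` -/

section CubicCarriers

variable {R : Polynomial ℤ} [Fact (Irreducible (realPolyQ R))]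

/-- `[F:ℚ] = 3` for a cubic carrier. [cite: Deligne1982HodgeCycles, §4 p. 30] -/
theorem finrank_realField_cubic {a b c : ℤ} (hR : R = X ^ 3 + C a * X ^ 2 + C b * X + C c) :
    Module.finrank ℚ (realField R) = 3 := by
  rw [finrank_realField, hR]; compute_degree!

/-- `realPolyQ (S³ + aS² + bS + c) = S³ + aS² + bS + c ∈ ℚ[S]`. [cite: Deligne1982HodgeCycles, §4 p. 30] -/
theorem realPolyQ_cubic {a b c : ℤ} (hR : R = X ^ 3 + C a * X ^ 2 + C b * X + C c) :
    realPolyQ R = X ^ 3 + C (a : ℚ) * X ^ 2 + C (b : ℚ) * X + C (c : ℚ) := by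
  subst hR
  show Polynomial.map (Int.castRingHom ℚ) (X ^ 3 + C a * X ^ 2 + C b * X + C c) = _
  rw [Polynomial.map_add, Polynomial.map_add, Polynomial.map_add, Polynomial.map_mul, Polynomial.map_mul,
    Polynomial.map_pow, Polynomial.map_pow, map_X, map_C, map_C, map_C, eq_intCast, eq_intCast, eq_intCast]

/-- `θ³ + aθ² + bθ + c = 0` in `F` for a cubic carrier. [cite: Deligne1982HodgeCycles, §4 p. 30] -/
theorem root_rel_cubic {a b c : ℤ} (hR : R = X ^ 3 + C a * X ^ 2 + C b * X + C c) :
    AdjoinRoot.root (realPolyQ R) ^ 3 + (a : ℚ) * AdjoinRoot.root (realPolyQ R) ^ 2 +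
      (b : ℚ) * AdjoinRoot.root (realPolyQ R) + (c : ℚ) = 0 := by
  have h : AdjoinRoot.mk (realPolyQ R) (X ^ 3 + C (a : ℚ) * X ^ 2 + C (b : ℚ) * X + C (c : ℚ)) = 0 := by
    rw [← realPolyQ_cubic hR]
    exact AdjoinRoot.mk_self
  rw [map_add, map_add, map_add, map_mul, map_mul, map_pow, map_pow, AdjoinRoot.mk_X, AdjoinRoot.mk_C,
    AdjoinRoot.mk_C, AdjoinRoot.mk_C] at h
  rw [← h, ← map_ratCast (AdjoinRoot.of (realPolyQ R)), ← map_ratCast (AdjoinRoot.of (realPolyQ R)),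
    ← map_ratCast (AdjoinRoot.of (realPolyQ R)), Rat.cast_intCast, Rat.cast_intCast, Rat.cast_intCast]

/-- `θₒ³ + aθₒ² + bθₒ + c = 0` in `𝓞_F` for an integral lift `θₒ` of `θ`. [cite: Deligne1982HodgeCycles, §4 p. 30] -/
theorem ringOfIntegers_root_rel_cubic {a b c : ℤ} (hR : R = X ^ 3 + C a * X ^ 2 + C b * X + C c)
    {θₒ : 𝓞 (realField R)} (hθ : (θₒ : realField R) = AdjoinRoot.root (realPolyQ R)) :
    θₒ ^ 3 + a * θₒ ^ 2 + b * θₒ + c = 0 := by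
  have h := root_rel_cubic hR
  rw [← hθ] at h
  refine RingOfIntegers.ext ?_
  simp only [map_add, map_mul, map_pow, map_intCast, map_zero]
  exact_mod_cast h

end CubicCarriers

/-! ### §21 `E = ℚ(ζ₉)`, `F = ℚ(ζ₉)⁺`, `R = S³ + 6S² + 9S + 3` (`θ = 2cos(2πk/9) - 2`): `2` is INERT in `F` and in
`E/F` — `v₂ ∈ T(q) ⟺ ord₂ q` odd (the «dyadic row» `[2] ≠ [1]` of §b03.24, uniformly) -/

section Zeta9

variable {R : Polynomial ℤ} [Fact (Irreducible (cmPolyQ R))] [Fact (Irreducible (realPolyQ R))]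

omit [Fact (Irreducible (cmPolyQ R))] in
/-- **Dyadic normalisation of the `ℚ(ζ₉)⁺` carrier**: `θ = (θ² + 5θ + 2)²·(1 + 4ρ)` with `ρ = -(2θ² + 11θ + 13)`
(`θ² + 5θ + 2 = (η² - 2)²·…` a cyclotomic unit, `η = θ + 2 = 2cos(2πk/9)`; found by a search over the units `±ηᵃ(η²-2)ᵇ`
modulo `4𝓞_F`). [folklore] -/
theorem zeta9_root_eq_sq_mul_one_add_four_mul (hR : R = X ^ 3 + C 6 * X ^ 2 + C 9 * X + C 3) {θₒ : 𝓞 (realField R)}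
    (hθ : (θₒ : realField R) = AdjoinRoot.root (realPolyQ R)) :
    AdjoinRoot.root (realPolyQ R) =
      (AdjoinRoot.root (realPolyQ R) ^ 2 + 5 * AdjoinRoot.root (realPolyQ R) + 2) ^ 2 *
        ((1 + 4 * (-(2 * θₒ ^ 2 + 11 * θₒ + 13)) : 𝓞 (realField R)) : realField R) := by
  have hrel := root_rel_cubic hR
  push_cast at hrel
  simp only [map_add, map_mul, map_one, map_ofNat, map_neg, map_pow, hθ]
  linear_combination (68 + 195 * AdjoinRoot.root (realPolyQ R) + 76 * AdjoinRoot.root (realPolyQ R) ^ 2 +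
    8 * AdjoinRoot.root (realPolyQ R) ^ 3) * hrel

omit [Fact (Irreducible (cmPolyQ R))] in
/-- `θ² - θ ∉ v₂` and `θ⁴ - θ ∉ v₂` (Bezout identities with `R` modulo `2`: `R̄ = S³ + S + 1` is irreducible over `𝔽₂`,
so `θ̄ ∉ 𝔽₄`): the dyadic residue field of `ℚ(ζ₉)⁺` is `𝔽₈`. [folklore] -/
theorem zeta9_sq_sub_self_notMem_and (hR : R = X ^ 3 + C 6 * X ^ 2 + C 9 * X + C 3) {θₒ : 𝓞 (realField R)}
    (hθ : (θₒ : realField R) = AdjoinRoot.root (realPolyQ R)) (v : HeightOneSpectrum (𝓞 (realField R)))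
    (h2 : (2 : 𝓞 (realField R)) ∈ v.asIdeal) : θₒ ^ 2 - θₒ ∉ v.asIdeal ∧ θₒ ^ 4 - θₒ ∉ v.asIdeal := by
  have hrel : θₒ ^ 3 + 6 * θₒ ^ 2 + 9 * θₒ + 3 = 0 := by simpa using ringOfIntegers_root_rel_cubic hR hθ
  have h1 : (1 : 𝓞 (realField R)) ∉ v.asIdeal := fun h ↦ v.isPrime.ne_top ((Ideal.eq_top_iff_one _).2 h)
  constructor
  · intro h
    refine h1 ?_
    have key : (1 : 𝓞 (realField R)) = (1 + θₒ) * (θₒ ^ 2 - θₒ) - (θₒ ^ 3 + 6 * θₒ ^ 2 + 9 * θₒ + 3) +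
        2 * (2 + 5 * θₒ + 3 * θₒ ^ 2) := by ring
    rw [key, hrel, sub_zero]
    exact v.asIdeal.add_mem (v.asIdeal.mul_mem_left _ h) (v.asIdeal.mul_mem_right _ h2)
  · intro h
    refine h1 ?_
    have key : (1 : 𝓞 (realField R)) = (1 + θₒ + θₒ ^ 2) * (θₒ ^ 4 - θₒ) -
        (-91 + 22 * θₒ - 5 * θₒ ^ 2 + θₒ ^ 3) * (θₒ ^ 3 + 6 * θₒ ^ 2 + 9 * θₒ + 3) -
        2 * (136 + 376 * θₒ + 181 * θₒ ^ 2) := by ring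
    rw [key, hrel, mul_zero, sub_zero]
    exact v.asIdeal.sub_mem (v.asIdeal.mul_mem_left _ h) (v.asIdeal.mul_mem_right _ h2)

omit [Fact (Irreducible (cmPolyQ R))] in
/-- **The dyadic place of `ℚ(ζ₉)⁺`: `v₂ = (2)`, unique, `ord 2 = 1`, residue field `𝔽₈` (`y⁸ ≡ y`).** [folklore] -/
theorem zeta9_dyadic (hR : R = X ^ 3 + C 6 * X ^ 2 + C 9 * X + C 3) {θₒ : 𝓞 (realField R)}
    (hθ : (θₒ : realField R) = AdjoinRoot.root (realPolyQ R)) (v : HeightOneSpectrum (𝓞 (realField R)))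
    (h2 : (2 : 𝓞 (realField R)) ∈ v.asIdeal) :
    v.asIdeal = Ideal.span {(2 : 𝓞 (realField R))} ∧ (∀ y : 𝓞 (realField R), y ^ 8 - y ∈ v.asIdeal) ∧
      WithZero.log (v.valuation (realField R) (2 : realField R)) = -1 ∧
      ∀ v' : HeightOneSpectrum (𝓞 (realField R)), (2 : 𝓞 (realField R)) ∈ v'.asIdeal → v' = v := by
  have hF := finrank_realField_cubic hR
  have hx := fun w (hw : (2 : 𝓞 (realField R)) ∈ w.asIdeal) ↦ zeta9_sq_sub_self_notMem_and hR hθ w hw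
  refine ⟨asIdeal_eq_span_two_of_dyadic_cubic hF v h2 (hx v h2).1 (hx v h2).2,
    pow_eight_sub_self_mem_of_dyadic hF v h2 (hx v h2).1 (hx v h2).2, ?_,
    fun v' h2' ↦ dyadic_unique_cubic hF v' v h2' h2 (hx v' h2').1 (hx v' h2').2 (hx v h2).1 (hx v h2).2⟩
  rw [show (2 : realField R) = algebraMap (𝓞 (realField R)) (realField R) 2 by rw [map_ofNat],
    HeightOneSpectrum.valuation_of_algebraMap, intValuation_two_of_dyadic_cubic hF v h2 (hx v h2).1 (hx v h2).2,
    WithZero.log_exp]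

omit [Fact (Irreducible (cmPolyQ R))] in
/-- **The dyadic place of `ℚ(ζ₉)⁺` is INERT in `ℚ(ζ₉)`**: `X² - X - ρ` has no root modulo `v₂` — the Artin–Schreier
trace `ρ̄ + ρ̄² + ρ̄⁴ ∈ 𝔽₂` of `ρ̄ ∈ 𝔽₈` is `1` (kernel: `r⁸ ≡ r`, the relation of `θ` and an explicit integer identity
force `1 ∈ v₂`). [folklore] -/
theorem zeta9_dyadic_inert (hR : R = X ^ 3 + C 6 * X ^ 2 + C 9 * X + C 3) {θₒ : 𝓞 (realField R)}
    (hθ : (θₒ : realField R) = AdjoinRoot.root (realPolyQ R)) (v : HeightOneSpectrum (𝓞 (realField R)))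
    (h2 : (2 : 𝓞 (realField R)) ∈ v.asIdeal) :
    ∀ r : 𝓞 (realField R), r ^ 2 - r - -(2 * θₒ ^ 2 + 11 * θₒ + 13) ∉ v.asIdeal := by
  intro r hr
  have hrel : θₒ ^ 3 + 6 * θₒ ^ 2 + 9 * θₒ + 3 = 0 := by simpa using ringOfIntegers_root_rel_cubic hR hθ
  have h8 := (zeta9_dyadic hR hθ v h2).2.1 r
  have key : (1 : 𝓞 (realField R)) = (r ^ 8 - r) -
      ((-1247) + (-3916 * θₒ) + (-4705 * θₒ ^ 2) + (-2783 * θₒ ^ 3) + (-858 * θₒ ^ 4) + (-132 * θₒ ^ 5) +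
        (-8 * θₒ ^ 6) + (456 * r) + (814 * r * θₒ) + (511 * r * θₒ ^ 2) + (132 * r * θₒ ^ 3) + (12 * r * θₒ ^ 4) +
        (131 * r ^ 2) + (253 * r ^ 2 * θₒ) + (167 * r ^ 2 * θₒ ^ 2) + (44 * r ^ 2 * θₒ ^ 3) + (4 * r ^ 2 * θₒ ^ 4) +
        (-25 * r ^ 3) + (-22 * r ^ 3 * θₒ) + (-4 * r ^ 3 * θₒ ^ 2) + (-12 * r ^ 4) + (-11 * r ^ 4 * θₒ) +
        (-2 * r ^ 4 * θₒ ^ 2) + (r ^ 5) + (r ^ 6)) * (r ^ 2 - r - -(2 * θₒ ^ 2 + 11 * θₒ + 13)) -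
      ((4536) + (7185 * θₒ) + (4816 * θₒ ^ 2) + (1592 * θₒ ^ 3) + (256 * θₒ ^ 4) + (16 * θₒ ^ 5) + (-1524 * r) +
        (-1184 * r * θₒ) + (-336 * r * θₒ ^ 2) + (-32 * r * θₒ ^ 3)) * (θₒ ^ 3 + 6 * θₒ ^ 2 + 9 * θₒ + 3) -
      2 * ((1301) + (1123 * θₒ) + (203 * θₒ ^ 2) + (-1302 * r) + (-1123 * r * θₒ) + (-203 * r * θₒ ^ 2)) := by
    ring
  have hmem : (1 : 𝓞 (realField R)) ∈ v.asIdeal := by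
    rw [key, hrel, mul_zero, sub_zero]
    exact v.asIdeal.sub_mem (v.asIdeal.sub_mem h8 (v.asIdeal.mul_mem_left _ hr)) (v.asIdeal.mul_mem_right _ h2)
  exact v.isPrime.ne_top ((Ideal.eq_top_iff_one _).2 hmem)

/-- **THE DYADIC COLUMN OF THE `ℚ(ζ₉)` TABLE: `v₂ ∈ T(q) ⟺ ord_{v₂} q` odd** (`= ord₂` on `ℚ`), for every `q ∈ F^×`.
[cite: Omeara1963, §63C Example 63:16] [cite: Deligne1982HodgeCycles, §4 (1)] -/
theorem zeta9_inl_mem_badPlaces_iff_odd_of_dyadic (hR : R = X ^ 3 + C 6 * X ^ 2 + C 9 * X + C 3)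
    {θₒ : 𝓞 (realField R)} (hθ : (θₒ : realField R) = AdjoinRoot.root (realPolyQ R))
    (v : HeightOneSpectrum (𝓞 (realField R))) (h2 : (2 : 𝓞 (realField R)) ∈ v.asIdeal) (q : (realField R)ˣ) :
    Sum.inl v ∈ badPlaces (q : realField R) (AdjoinRoot.root (realPolyQ R)) ↔
      Odd (WithZero.log (v.valuation (realField R) (q : realField R))) :=
  inl_mem_badPlaces_iff_odd_of_dyadic_inert (zeta9_root_eq_sq_mul_one_add_four_mul hR hθ) v h2
    (zeta9_dyadic_inert hR hθ v h2) q

/-- **The dyadic rows of `ℚ(ζ₉)`**: `[2w] ≠ [(-1)^k]` for every `v₂`-unit `w ∈ 𝓞_F` (every odd integer) and every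
`E`-rank `2k` (§b03.24: `[2] ≠ [1]`). [cite: Deligne1982HodgeCycles, §4 (1) and Cor. 4.2] [cite: Omeara1963, §63C Example 63:16] -/
theorem zeta9_mk_two_mul_ne_splitDiscriminantClassCM (hR : R = X ^ 3 + C 6 * X ^ 2 + C 9 * X + C 3)
    {θₒ : 𝓞 (realField R)} (hθ : (θₒ : realField R) = AdjoinRoot.root (realPolyQ R))
    (v : HeightOneSpectrum (𝓞 (realField R))) (h2 : (2 : 𝓞 (realField R)) ∈ v.asIdeal) {w : 𝓞 (realField R)}
    (hw : w ∉ v.asIdeal) (q : (realField R)ˣ) (hq : (q : realField R) = 2 * (w : realField R)) (k : ℕ) :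
    (QuotientGroup.mk q : cmNormResidueGroup R) ≠ splitDiscriminantClassCM R k := by
  refine mk_ne_splitDiscriminantClassCM_of_odd_log_valuation_dyadic (zeta9_root_eq_sq_mul_one_add_four_mul hR hθ) v h2
    (zeta9_dyadic_inert hR hθ v h2) ?_ k
  have h20 : v.valuation (realField R) (2 : realField R) ≠ 0 := (Valuation.ne_zero_iff _).2 two_ne_zero
  have hw0 : v.valuation (realField R) (w : realField R) ≠ 0 := by
    refine (Valuation.ne_zero_iff _).2 fun h ↦ hw ?_
    rw [show w = 0 from RingOfIntegers.coe_injective (by simpa using h)]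
    exact v.asIdeal.zero_mem
  have hw1 : WithZero.log (v.valuation (realField R) (w : realField R)) = 0 := by
    rw [show (w : realField R) = algebraMap (𝓞 (realField R)) (realField R) w from rfl,
      HeightOneSpectrum.valuation_of_algebraMap, HeightOneSpectrum.intValuation_eq_one_iff.2 hw, WithZero.log_one]
  rw [hq, map_mul, WithZero.log_mul h20 hw0, (zeta9_dyadic hR hθ v h2).2.2.1, hw1]
  decide

end Zeta9

/-! ### §22 `E = ℚ(ζ₇)`, `F = ℚ(ζ₇)⁺`, `R = S³ + 7S² + 14S + 7` (`θ = 2cos(2πk/7) - 2`): `2` is INERT in `F` and SPLIT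
in `E/F` — `v₂` lies in no `T(q)` (§b03.24: `[2] = [1]`, `2 = x² + 7y²`-type) -/

section Zeta7

variable {R : Polynomial ℤ} [Fact (Irreducible (cmPolyQ R))] [Fact (Irreducible (realPolyQ R))]

omit [Fact (Irreducible (cmPolyQ R))] in
/-- **Dyadic normalisation of the `ℚ(ζ₇)⁺` carrier**: `θ = (θ² + 5θ + 3)²·(1 + 4ρ)` with `ρ = -(θ² + 6θ + 9)`
(`θ² + 5θ + 3` a cyclotomic unit). [folklore] -/
theorem zeta7_root_eq_sq_mul_one_add_four_mul (hR : R = X ^ 3 + C 7 * X ^ 2 + C 14 * X + C 7) {θₒ : 𝓞 (realField R)}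
    (hθ : (θₒ : realField R) = AdjoinRoot.root (realPolyQ R)) :
    AdjoinRoot.root (realPolyQ R) =
      (AdjoinRoot.root (realPolyQ R) ^ 2 + 5 * AdjoinRoot.root (realPolyQ R) + 3) ^ 2 *
        ((1 + 4 * (-(θₒ ^ 2 + 6 * θₒ + 9)) : 𝓞 (realField R)) : realField R) := by
  have hrel := root_rel_cubic hR
  push_cast at hrel
  simp only [map_add, map_mul, map_one, map_ofNat, map_neg, map_pow, hθ]
  linear_combination (45 + 91 * AdjoinRoot.root (realPolyQ R) + 36 * AdjoinRoot.root (realPolyQ R) ^ 2 +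
    4 * AdjoinRoot.root (realPolyQ R) ^ 3) * hrel

omit [Fact (Irreducible (cmPolyQ R))] in
/-- `θ² - θ ∉ v₂` and `θ⁴ - θ ∉ v₂` for `ℚ(ζ₇)⁺` (`R̄ = S³ + S² + 1` irreducible over `𝔽₂`): the dyadic residue field is
`𝔽₈`. [folklore] -/
theorem zeta7_sq_sub_self_notMem_and (hR : R = X ^ 3 + C 7 * X ^ 2 + C 14 * X + C 7) {θₒ : 𝓞 (realField R)}
    (hθ : (θₒ : realField R) = AdjoinRoot.root (realPolyQ R)) (v : HeightOneSpectrum (𝓞 (realField R)))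
    (h2 : (2 : 𝓞 (realField R)) ∈ v.asIdeal) : θₒ ^ 2 - θₒ ∉ v.asIdeal ∧ θₒ ^ 4 - θₒ ∉ v.asIdeal := by
  have hrel : θₒ ^ 3 + 7 * θₒ ^ 2 + 14 * θₒ + 7 = 0 := by simpa using ringOfIntegers_root_rel_cubic hR hθ
  have h1 : (1 : 𝓞 (realField R)) ∉ v.asIdeal := fun h ↦ v.isPrime.ne_top ((Ideal.eq_top_iff_one _).2 h)
  constructor
  · intro h
    refine h1 ?_
    have key : (1 : 𝓞 (realField R)) = θₒ * (θₒ ^ 2 - θₒ) - (θₒ ^ 3 + 7 * θₒ ^ 2 + 14 * θₒ + 7) +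
        2 * (4 + 7 * θₒ + 4 * θₒ ^ 2) := by ring
    rw [key, hrel, sub_zero]
    exact v.asIdeal.add_mem (v.asIdeal.mul_mem_left _ h) (v.asIdeal.mul_mem_right _ h2)
  · intro h
    refine h1 ?_
    have key : (1 : 𝓞 (realField R)) = (1 + θₒ + θₒ ^ 2) * (θₒ ^ 4 - θₒ) -
        (-127 + 29 * θₒ - 6 * θₒ ^ 2 + θₒ ^ 3) * (θₒ ^ 3 + 7 * θₒ ^ 2 + 14 * θₒ + 7) -
        2 * (444 + 787 * θₒ + 262 * θₒ ^ 2) := by ring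
    rw [key, hrel, mul_zero, sub_zero]
    exact v.asIdeal.sub_mem (v.asIdeal.mul_mem_left _ h) (v.asIdeal.mul_mem_right _ h2)

omit [Fact (Irreducible (cmPolyQ R))] in
/-- **The dyadic place of `ℚ(ζ₇)⁺`: `v₂ = (2)`, unique, `ord 2 = 1`, residue field `𝔽₈`.** [folklore] -/
theorem zeta7_dyadic (hR : R = X ^ 3 + C 7 * X ^ 2 + C 14 * X + C 7) {θₒ : 𝓞 (realField R)}
    (hθ : (θₒ : realField R) = AdjoinRoot.root (realPolyQ R)) (v : HeightOneSpectrum (𝓞 (realField R)))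
    (h2 : (2 : 𝓞 (realField R)) ∈ v.asIdeal) :
    v.asIdeal = Ideal.span {(2 : 𝓞 (realField R))} ∧ (∀ y : 𝓞 (realField R), y ^ 8 - y ∈ v.asIdeal) ∧
      WithZero.log (v.valuation (realField R) (2 : realField R)) = -1 ∧
      ∀ v' : HeightOneSpectrum (𝓞 (realField R)), (2 : 𝓞 (realField R)) ∈ v'.asIdeal → v' = v := by
  have hF := finrank_realField_cubic hR
  have hx := fun w (hw : (2 : 𝓞 (realField R)) ∈ w.asIdeal) ↦ zeta7_sq_sub_self_notMem_and hR hθ w hw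
  refine ⟨asIdeal_eq_span_two_of_dyadic_cubic hF v h2 (hx v h2).1 (hx v h2).2,
    pow_eight_sub_self_mem_of_dyadic hF v h2 (hx v h2).1 (hx v h2).2, ?_,
    fun v' h2' ↦ dyadic_unique_cubic hF v' v h2' h2 (hx v' h2').1 (hx v' h2').2 (hx v h2).1 (hx v h2).2⟩
  rw [show (2 : realField R) = algebraMap (𝓞 (realField R)) (realField R) 2 by rw [map_ofNat],
    HeightOneSpectrum.valuation_of_algebraMap, intValuation_two_of_dyadic_cubic hF v h2 (hx v h2).1 (hx v h2).2,
    WithZero.log_exp]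

omit [Fact (Irreducible (cmPolyQ R))] in
/-- **The dyadic place of `ℚ(ζ₇)⁺` is SPLIT in `ℚ(ζ₇)`**: `r = θ² + θ` is a root of `X² - X - ρ` modulo `v₂`
(`r² - r - ρ = (θ - 5)·R(θ) + 2(11θ² + 34θ + 22)`; `2` has TWO primes in `ℚ(ζ₇)` above the one of `ℚ(ζ₇)⁺`). [folklore] -/
theorem zeta7_dyadic_split (hR : R = X ^ 3 + C 7 * X ^ 2 + C 14 * X + C 7) {θₒ : 𝓞 (realField R)}
    (hθ : (θₒ : realField R) = AdjoinRoot.root (realPolyQ R)) (v : HeightOneSpectrum (𝓞 (realField R)))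
    (h2 : (2 : 𝓞 (realField R)) ∈ v.asIdeal) :
    ∃ r : 𝓞 (realField R), r ^ 2 - r - -(θₒ ^ 2 + 6 * θₒ + 9) ∈ v.asIdeal := by
  have hrel : θₒ ^ 3 + 7 * θₒ ^ 2 + 14 * θₒ + 7 = 0 := by simpa using ringOfIntegers_root_rel_cubic hR hθ
  refine ⟨θₒ ^ 2 + θₒ, ?_⟩
  have key : (θₒ ^ 2 + θₒ) ^ 2 - (θₒ ^ 2 + θₒ) - -(θₒ ^ 2 + 6 * θₒ + 9) =
      (θₒ - 5) * (θₒ ^ 3 + 7 * θₒ ^ 2 + 14 * θₒ + 7) + 2 * (11 * θₒ ^ 2 + 34 * θₒ + 22) := by ring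
  rw [key, hrel, mul_zero, zero_add]
  exact v.asIdeal.mul_mem_right _ h2

/-- **THE DYADIC COLUMN OF THE `ℚ(ζ₇)` TABLE IS EMPTY: `v₂ ∉ T(q)` for every `q ∈ F^×`** (§b03.24: `[2] = [1]`,
`[ℓ] = [1] ⟺ ℓ = 7 ∨ ℓ ≡ 1, 2, 4 (7)`). [cite: Omeara1963, §63C Example 63:16] [cite: Deligne1982HodgeCycles, §4 (1)] -/
theorem zeta7_inl_notMem_badPlaces_of_dyadic (hR : R = X ^ 3 + C 7 * X ^ 2 + C 14 * X + C 7)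
    {θₒ : 𝓞 (realField R)} (hθ : (θₒ : realField R) = AdjoinRoot.root (realPolyQ R))
    (v : HeightOneSpectrum (𝓞 (realField R))) (h2 : (2 : 𝓞 (realField R)) ∈ v.asIdeal) (q : (realField R)ˣ) :
    Sum.inl v ∉ badPlaces (q : realField R) (AdjoinRoot.root (realPolyQ R)) :=
  inl_notMem_badPlaces_of_dyadic_split (zeta7_root_eq_sq_mul_one_add_four_mul hR hθ) v h2
    (zeta7_dyadic_split hR hθ v h2) q

end Zeta7

end Summit.HodgeConjecture.HodgeConjecture.Ring2.WeilCoverageCM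

end
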